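import Literature.AlgebraicGeometry.Motives.HodgeStructureWeylOperatorBeauvilleForm
import Literature.AlgebraicGeometry.Motives.HodgeStructureCupProductCorrespondences
import HarnessLib

/-!
# The cohomological Fourier transform `ℱ = (e^℘)_*`, `℘ = p^*θ + q^*θ − m^*θ`, of a principally polarized abelian variety on
# `H•(X) = ⋀W` IS THE WEYL ELEMENT of the Lefschetz `𝔰𝔩₂`: `ℱ = w = exp(−L) exp(Λ) exp(−L)` (Beauville 2010, "`(0 −1 ; 1 0)·z = ℱ(z)`")

[topic AlgebraicGeometry/Motives]

Layer `Literature/AlgebraicGeometry/Motives`, lane `lit-hodgefound` (Track 2 foundations library; prover seat `lit-hodgefound-p34`,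
generation 37, row g37-#3). TWO DEFINITIONS WITH BODIES (`poincareClass ω = ℘`, `fourierTransform ω g = ℱ`) and theorems; no named
fact, no instance, no notation (net debt `0`). Sequel of row g37-#2 (`HodgeStructureWeylOperatorBeauvilleForm`: `w x = e^{−ω} ∧ ((e^{−ω} ∧ x)
⋆ e^{ω})` for the tree's Weyl element `w = weylStar ω g`), of rows g32-#1/#2 (`kunnethEquiv = Φ`, `gysinSnd = q_*`, Milne's dictionary
`corrMap : u ↦ ū = q_*(p^* · ∪ u)`), g32-#6 (`IsSymplectic.pushforward`, the Gysin map CHARACTERISED by the projection formula) and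
g35-#2 (`IsSymplectic.pontryagin`: `x ⋆ y = μ_*(p^*x ∪ q^*y)`) and g33 (`HodgeStructureCupProductCorrespondences`:
`(u ∧ q^*z)‾ = (· ∧ z) ∘ ū`, `(p^*z ∧ u)‾ = ū ∘ (· ∧ z)`).

THE SETTING. `K` a field of characteristic `0`, `ω ∈ ⋀²W` symplectic of genus `g` (`dim W = 2g`): `H•(X) = ⋀W`, `H•(X × X) = ⋀(W ⊕ W)`,
`p^* = ⋀(inl)`, `q^* = ⋀(inr)`, `m^* = μ^* = ⋀(v ↦ (v, v))`, `δ^* = ⋀(v ↦ (−v, v))` (`δ(a, b) = b − a`), orientation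
`Ω = ω ⊞ ω = p^*ω + q^*ω` of genus `2g` on `X × X`, `q_* = gysinSnd ω g`, `μ_* = hω.pushforward Ω (g+g) μ^*`. The polarization is
PRINCIPAL and `X̂` is identified with `X` through it (`d = 1`), exactly Beauville's convention "`φ(a) = 𝒪_A(Θ_a − Θ)`. With this
convention […] the class […] of the Poincaré bundle is `p^*θ + q^*θ − m^*θ`".

## Source, VERBATIM

A. Beauville, *The action of `SL₂` on abelian varieties*, J. Ramanujan Math. Soc. **25** (2010) 253–263, arXiv:0805.1541 [Beauville2010SL2]
(held text `paper:arxiv-0805.1541`): §1 (p0002): "To a class `α` in `Corr(A)` we associate a `ℚ`-linear map `α_* : CH(A) → CH(A)` defined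
by `α_* z = q_*(α · p^*z)` […] (a) […] `Δ_*z ∘ α = α · q^*z`, `α ∘ Δ_*z = α · p^*z`"; (p0002): "the class in `CH¹(A × A)` of the Poincaré
bundle is `p^*θ + q^*θ − m^*θ`, where `m : A × A → A` is the addition map". §3, proof of the Theorem (p0004): "put `v = (1 0 ; 1 1)`; we have
`v = uwu`. Thus […] `φ(v) = Δ_*e^θ ∘ e^℘ ∘ Δ_*e^θ = e^{℘ + p^*θ + q^*θ}`. Since `℘ = p^*θ + q^*θ − m^*θ` and `m^*θ + δ^*θ = 2p^*θ + 2q^*θ` by the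
seesaw theorem, this gives `φ(v) = e^{δ^*θ}`." §4 (p0005): "We will denote by `ℱ` the `ℚ`-linear automorphism `d⁻¹(e^℘)_*` of `CH(A)`; this
is the Fourier transform for Chow groups, see [B1] and [B2]. **Theorem** […] `(0 −1 ; 1 0)·z = ℱ(z)`, `(1 a ; 0 1)·z = e^{aθ}z`,
`(1 0 ; a 1)·z = d⁻¹aᵍe^{θ/a} ⋆ z` […] *Proof*: […] Let `σ` be the automorphism of `A × A` defined by `σ(a, b) = (b, a + b)`. We have
`q ∘ σ = m`, `p ∘ σ = q`, `δ ∘ σ = p`, hence `(e^{δ^*θ/a})_* z = q_*σ_*σ^*(e^{δ^*θ/a} · p^*z) = m_*(p^*e^{θ/a} · q^*z) = e^{θ/a} ⋆ z`."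
§5 (p0006): "**Corollary** Let `z ∈ CH^p_s(A)` be a primitive element, and let `q ≤ g+s−2p`. Then `ℱ(θ^q/q! z) = (−θ)^r/r! z`, with
`r = g+s−2p−q`."
H. Lange, *Abelian Varieties over the Complex Numbers* (2023) [Lange2023AbelianVarietiesComplex], §6.3.2 Thm. 6.3.5 (p0315): "`F(L^{·p}/p!) =
((−1)^{g−p}/d) φ_{L*}(L^{·(g−p)}/(g−p)!)`" (Beauville 1983), Cor. 6.2.16 (`F(1) = (−1)^g [pt]`).

## How the printed proof is followed

Beauville obtains `ℱ = w` from Mukai's relations in `D(A)` and Demazure's presentation of `SL₂`; on the carrier the same MATRIX identity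
`w = (0 −1 ; 1 0) = u⁻¹ v u⁻¹` is read off directly: with `℘ = δ^*θ − p^*θ − q^*θ` (seesaw, §2) and `e^℘ = δ^*e^{θ} · p^*e^{−θ} · q^*e^{−θ}`,
Beauville's two formulas (a) give `(e^℘)_* z = e^{−θ} · (δ^*e^{θ})_*(e^{−θ} · z)`, his `σ`-computation gives `(δ^*α)_* z = z ⋆ α` (§1, with
`σ` followed by the swap: the shear `T(u, v) = (u + v, v)` of `W ⊕ W`, `⋀T p^* = p^*`, `⋀T q^* = μ^*`, `⋀T δ^* = q^*`, `μ_* ∘ ⋀T = q_*` by the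
uniqueness of Gysin maps — `⋀T` fixes the orientation `Ω^{2g}`), so `ℱ z = e^{−θ} · ((e^{−θ} · z) ⋆ e^{θ}) = exp(−L) exp(Λ) exp(−L) z = w z`
by row g37-#2 (`weylStar_apply_eq_pontryagin`).

## What is DEFINED and PROVED

* §1 **`IsSymplectic.map_inl_pow_genus_mul_map_prod`** (`p^*(ω^g) ∧ μ^*y = p^*(ω^g) ∧ q^*y`), `IsSymplectic.map_shear_pow`
  (`⋀T Ω^{2g} = Ω^{2g}`), `IsSymplectic.trace_map_shear` (`τ_Ω ∘ ⋀T = τ_Ω`), **`IsSymplectic.pushforward_map_shear`** (`μ_*(⋀T u) = q_* u`),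
  **`IsSymplectic.corrMap_map_sub_apply`: `(δ^*α)_* z = z ⋆ α`** (THE CORRESPONDENCE `δ^*α` ACTS AS PONTRYAGIN PRODUCT WITH `α`).
* §2 `poincareClass ω = ℘ := p^*ω + q^*ω − μ^*ω`; `IsSymplectic.map_prod_add_map_sub` (seesaw `μ^*ω + δ^*ω = 2(p^*ω + q^*ω)` in `⋀²`),
  `IsSymplectic.poincareClass_eq` (`℘ = δ^*ω − p^*ω − q^*ω`), `poincareClass_mem` (`℘ ∈ ⋀²`), private `exp_map_eq_of_pow_eq_zero`,
  **`IsSymplectic.sum_inv_factorial_smul_poincareClass_pow`: `e^℘ = δ^*e^{ω} · p^*e^{−ω} · q^*e^{−ω}`** (Beauville's (a):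
  `(u · q^*b)_* z = u_* z ∧ b`, `(p^*a · u)_* z = u_*(z ∧ a)` are the tree's `corrMap_mul_map_inr_apply`, `corrMap_map_inl_mul_apply`, row g33).
* §3 `fourierTransform ω g = ℱ := corrMap ω g (Σ_{j≤2g} ℘^j/j!)`; **`IsSymplectic.fourierTransform_apply_eq`: `ℱ x = e^{−ω} ∧ ((e^{−ω} ∧ x) ⋆
  e^{ω})`**; **`IsSymplectic.fourierTransform_eq_weylStar`: `ℱ = w`** (BEAUVILLE'S THEOREM "`(0 −1 ; 1 0)·z = ℱ(z)`" on `H•`).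
* §4 consequences (`g ≥ 1`): `fourierTransform_apply_mem` (`ℱ ⋀ᵏ ⊆ ⋀^{2g−k}`), `fourierTransform_fourierTransform_apply` (`ℱ² = (−1)^{g+k}`
  on `⋀ᵏ`: "`(−1 0 ; 0 −1)`"), `fourierTransform_pow_four` (`ℱ⁴ = 1`), `fourierTransform_mul_mul` / `fourierTransform_mul_lefschetzDual`
  (`ℱ L = −Λ ℱ`, `ℱ Λ = −L ℱ`), `fourierTransform_apply_eq_smul_andreStar` (`ℱ = (−1)^{g + C(k,2)} *_H` on `⋀ᵏ`, André), `map_fourierTransform`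
  (`Sp(ω)`-equivariance), `fourierTransform_mem_adjoin` (`ℱ ∈ K[L, Λ]`), **`fourierTransform_mul_fourierTransform`** (MUKAI INVERSION
  `ℱ ∘ ℱ = (−1)^g (−1)^*` as operators), `fourierTransform_bijective`, **`trace_fourierTransform_mul`** (PARSEVAL `τ(ℱx ∧ y) = τ(x ∧ ℱy)`), **`fourierTransform_apply_inv_factorial_smul_pow_mul_of_mem_primitive`**
  (BEAUVILLE'S COROLLARY `ℱ(ω^q/q! ∧ p) = (−ω)^r/r! ∧ p`), `fourierTransform_inv_factorial_smul_pow` (`ℱ(ω^q/q!) = (−ω)^{g−q}/(g−q)!`, Lange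
  Thm. 6.3.5 for `d = 1`), `fourierTransform_one` (`ℱ(1) = (−ω)^g/g! = (−1)^g[pt]`, Cor. 6.2.16), `fourierTransform_point` (`ℱ[pt] = 1`).

TWIN NOTICE (RULING 29 bis): the torus-forms carrier (`Geometry/Kaehler/ComplexTorusFourierCohomology`, `…FourierInversion`,
`…FourierPontryagin`, `…BeauvilleFourierPolarization{,General}`, `…DivisorClassesFourierPontryagin`: `fourierForm`, Lange §6.2–6.3 for all
types `(d_1, …, d_g)`) — BY NAME, nothing imported or restated; the present file is the principal case on the abstract carrier `⋀W` and
its identification with the Weyl element, which the torus files do not state.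

## References

* [Beauville2010SL2] A. Beauville, *The action of `SL₂` on abelian varieties*, J. Ramanujan Math. Soc. 25 (2010) 253–263, arXiv:0805.1541,
  §1 (a), §2, §3 (Theorem, proof), §4 (Theorem, proof), §5 (Corollary).
* [Beauville1983FourierChow] A. Beauville, *Quelques remarques sur la transformation de Fourier dans l'anneau de Chow d'une variété
  abélienne*, LNM 1016 (1983) 238–260.
* [Lange2023AbelianVarietiesComplex] H. Lange, *Abelian Varieties over the Complex Numbers* (2023), §2.5.3 (Pontryagin product), §6.2.4
  (6.11), §6.2.3 Thm. 6.2.15 / Cor. 6.2.16, §6.2.4 Prop. 6.2.20, §6.3.2 Thm. 6.3.5 (p0315).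
* [Voisin2002] C. Voisin, *Hodge Theory and Complex Algebraic Geometry I* (2002), §6.2.1 Lemma 6.19.
* [Milne1999LefschetzClasses] J. S. Milne, *Lefschetz classes on abelian varieties*, Duke Math. J. 96 (1999), §5 pp. 663–664.
* [Andre1996Motifs] Y. André, *Pour une théorie inconditionnelle des motifs*, Publ. Math. IHÉS 83 (1996), §1.2 (p. 11).
-/

noncomputable section

open scoped TensorProduct Nat

namespace Literature.AlgebraicGeometry.Motives

namespace ExteriorLefschetz

open ExteriorAlgebra Literature.Algebra.Lie
open Literature.LinearAlgebra.Alternating (ι_mem_exteriorPower_one)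

variable {K : Type*} [Field K] [CharZero K] {W : Type*} [AddCommGroup W] [Module K W] {ω : ExteriorAlgebra K W} {g : ℕ}

/-! ## §1 Beauville's change of coordinates `σ` (as the shear `T(u, v) = (u + v, v)`) and `(δ^*α)_* z = z ⋆ α` -/

omit [CharZero K] in
/-- `⋀T ∘ p^* = p^*` for the shear `T(u, v) = (u + v, v)` of `W ⊕ W` (`T ∘ inl = inl`; Beauville's `σ` followed by the swap of the factors:
`δ ∘ σ = p`, `p ∘ σ = q`, `q ∘ σ = m`). [cite: Beauville2010SL2, §4 (proof of the Theorem, the automorphism σ)] -/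
theorem map_shear_map_inl (z : ExteriorAlgebra K W) :
    ExteriorAlgebra.map ((LinearMap.fst K W W + LinearMap.snd K W W).prod (LinearMap.snd K W W))
      (ExteriorAlgebra.map (LinearMap.inl K W W) z) = ExteriorAlgebra.map (LinearMap.inl K W W) z := by
  have h : (LinearMap.fst K W W + LinearMap.snd K W W).prod (LinearMap.snd K W W) ∘ₗ LinearMap.inl K W W = LinearMap.inl K W W := by
    ext v <;> simp
  rw [← AlgHom.comp_apply, map_comp_map, h]

omit [CharZero K] in
/-- `⋀T ∘ q^* = μ^*` (`T ∘ inr = (v ↦ (v, v))`: "`q ∘ σ = m`"). [cite: Beauville2010SL2, §4 (proof of the Theorem)] -/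
theorem map_shear_map_inr (z : ExteriorAlgebra K W) :
    ExteriorAlgebra.map ((LinearMap.fst K W W + LinearMap.snd K W W).prod (LinearMap.snd K W W))
      (ExteriorAlgebra.map (LinearMap.inr K W W) z) = ExteriorAlgebra.map (LinearMap.id.prod LinearMap.id : W →ₗ[K] W × W) z := by
  have h : (LinearMap.fst K W W + LinearMap.snd K W W).prod (LinearMap.snd K W W) ∘ₗ LinearMap.inr K W W =
      (LinearMap.id.prod LinearMap.id : W →ₗ[K] W × W) := by
    ext v <;> simp
  rw [← AlgHom.comp_apply, map_comp_map, h]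

omit [CharZero K] in
/-- `⋀T ∘ δ^* = q^*` (`T(−v, v) = (0, v)`: "`p ∘ σ = q`" after the swap), `δ^* = ⋀(inr − inl)`. [cite: Beauville2010SL2, §4 (proof of the Theorem)] -/
theorem map_shear_map_sub (z : ExteriorAlgebra K W) :
    ExteriorAlgebra.map ((LinearMap.fst K W W + LinearMap.snd K W W).prod (LinearMap.snd K W W))
      (ExteriorAlgebra.map (LinearMap.inr K W W - LinearMap.inl K W W) z) = ExteriorAlgebra.map (LinearMap.inr K W W) z := by
  have h : (LinearMap.fst K W W + LinearMap.snd K W W).prod (LinearMap.snd K W W) ∘ₗ (LinearMap.inr K W W - LinearMap.inl K W W) =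
      LinearMap.inr K W W := by
    ext v <;> simp
  rw [← AlgHom.comp_apply, map_comp_map, h]

omit [CharZero K] in
/-- **`p^*(ω^g) ∧ μ^*y = p^*(ω^g) ∧ q^*y`**: modulo the ideal of `p^*(H^{>0})`, which `p^*(ω^g) = p^*[pt]` annihilates (`ω^g ∧ v = 0` in
`⋀^{2g+1}W = 0`), the pull-back by the addition map is the pull-back by the second projection (`μ^*v = p^*v + q^*v` on `H¹`). By induction
on the exterior algebra. [cite: Beauville2010SL2, §4 (proof of the Theorem)] [cite: Lange2023AbelianVarietiesComplex, §2.5.3 Prop. 2.5.13 (p0134)] -/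
theorem IsSymplectic.map_inl_pow_genus_mul_map_prod (hω : IsSymplectic ω g) (y : ExteriorAlgebra K W) :
    ExteriorAlgebra.map (LinearMap.inl K W W) (ω ^ g) * ExteriorAlgebra.map (LinearMap.id.prod LinearMap.id : W →ₗ[K] W × W) y =
      ExteriorAlgebra.map (LinearMap.inl K W W) (ω ^ g) * ExteriorAlgebra.map (LinearMap.inr K W W) y := by
  have hc : ∀ z : ExteriorAlgebra K (W × W), ExteriorAlgebra.map (LinearMap.inl K W W) (ω ^ g) * z =
      z * ExteriorAlgebra.map (LinearMap.inl K W W) (ω ^ g) := fun z ↦ by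
    rw [map_pow]
    exact pow_mul_comm_of_mem_two (map_mem_exteriorPower _ hω.mem) g z
  induction y using ExteriorAlgebra.induction with
  | algebraMap r => rw [AlgHom.commutes, AlgHom.commutes]
  | ι w =>
    have hsum : (LinearMap.id.prod LinearMap.id : W →ₗ[K] W × W) w = LinearMap.inl K W W w + LinearMap.inr K W W w := by
      ext <;> simp
    have h0 : ω ^ g * ι K w = 0 := by
      have hm : ω ^ g * ι K w ∈ ⋀[K]^(2 * g + 1) W :=
        SetLike.mul_mem_graded (pow_mem_exteriorPower hω.mem g) (ι_mem_exteriorPower_one K w)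
      rwa [hω.exteriorPower_eq_bot (by omega), Submodule.mem_bot] at hm
    rw [map_apply_ι, map_apply_ι, hsum, map_add, mul_add, ← map_apply_ι, ← map_mul, h0, map_zero, zero_add]
  | mul a b ha hb => rw [map_mul, map_mul, ← mul_assoc, ha, hc, mul_assoc, hb, ← mul_assoc, ← hc, mul_assoc]
  | add a b ha hb => rw [map_add, map_add, mul_add, mul_add, ha, hb]

/-- **`⋀T` fixes the orientation: `⋀T(Ω^{2g}) = Ω^{2g}`** for `Ω = p^*ω + q^*ω` (`Ω^{2g} = C(2g, g) p^*ω^g ∧ q^*ω^g`, `⋀T q^*ω^g = μ^*ω^g`,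
and `p^*ω^g ∧ μ^*ω^g = p^*ω^g ∧ q^*ω^g`) — "`σ_*σ^* = 1`", `σ` has degree one. [cite: Beauville2010SL2, §4 (proof of the Theorem, "q_*σ_*σ^*")] -/
theorem IsSymplectic.map_shear_pow (hω : IsSymplectic ω g) :
    ExteriorAlgebra.map ((LinearMap.fst K W W + LinearMap.snd K W W).prod (LinearMap.snd K W W))
        ((ExteriorAlgebra.map (LinearMap.inl K W W) ω + ExteriorAlgebra.map (LinearMap.inr K W W) ω) ^ (g + g)) =
      (ExteriorAlgebra.map (LinearMap.inl K W W) ω + ExteriorAlgebra.map (LinearMap.inr K W W) ω) ^ (g + g) := by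
  rw [hω.inl_add_inr_pow_add hω, map_smul, map_mul, map_shear_map_inl, map_shear_map_inr, hω.map_inl_pow_genus_mul_map_prod]

/-- **`⋀T` is the identity on the top degree `⋀^{4g}(W ⊕ W)`** (spanned by `Ω^{2g}`). [cite: Beauville2010SL2, §4 (proof of the Theorem)] -/
theorem IsSymplectic.map_shear_of_mem_top (hω : IsSymplectic ω g) {z : ExteriorAlgebra K (W × W)} (hz : z ∈ ⋀[K]^(2 * (g + g)) (W × W)) :
    ExteriorAlgebra.map ((LinearMap.fst K W W + LinearMap.snd K W W).prod (LinearMap.snd K W W)) z = z := by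
  have hΩ := hω.inl_add_inr hω
  have hf : (((g + g) ! : ℕ) : K) ≠ 0 := by exact_mod_cast Nat.factorial_ne_zero _
  have key := hΩ.factorial_smul_eq_trace_smul_pow hz
  have hz' : z = ((((g + g) ! : ℕ) : K))⁻¹ •
      (trace (ExteriorAlgebra.map (LinearMap.inl K W W) ω + ExteriorAlgebra.map (LinearMap.inr K W W) ω) (g + g) z •
        (ExteriorAlgebra.map (LinearMap.inl K W W) ω + ExteriorAlgebra.map (LinearMap.inr K W W) ω) ^ (g + g)) := by
    rw [← key, smul_smul, inv_mul_cancel₀ hf, one_smul]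
  conv_lhs => rw [hz', map_smul, map_smul, hω.map_shear_pow, ← hz']

/-- **`τ_Ω ∘ ⋀T = τ_Ω`**: the shear preserves the orientation of `X × X`. [cite: Beauville2010SL2, §4 (proof of the Theorem)] -/
theorem IsSymplectic.trace_map_shear (hω : IsSymplectic ω g) (z : ExteriorAlgebra K (W × W)) :
    trace (ExteriorAlgebra.map (LinearMap.inl K W W) ω + ExteriorAlgebra.map (LinearMap.inr K W W) ω) (g + g)
        (ExteriorAlgebra.map ((LinearMap.fst K W W + LinearMap.snd K W W).prod (LinearMap.snd K W W)) z) =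
      trace (ExteriorAlgebra.map (LinearMap.inl K W W) ω + ExteriorAlgebra.map (LinearMap.inr K W W) ω) (g + g) z := by
  induction z using DirectSum.Decomposition.inductionOn (fun i : ℕ ↦ ⋀[K]^i (W × W)) with
  | zero => rw [map_zero]
  | add z z' hz hz' => rw [map_add, map_add, hz, hz', map_add]
  | @homogeneous i z =>
    by_cases hi : i = 2 * (g + g)
    · rw [hω.map_shear_of_mem_top (hi ▸ z.2)]
    · rw [trace_apply_of_mem_ne (map_mem_exteriorPower _ z.2) hi, trace_apply_of_mem_ne z.2 hi]

/-- **`μ_* ∘ ⋀T = q_*`** (Beauville's "`q_*σ_* σ^* = …`, `q ∘ σ = m`" in the Gysin-map calculus of the carrier): by the UNIQUENESS of Gysin maps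
(`eq_gysinSnd_of_forall_trace_mul_eq`), since `τ_ω(y ∧ μ_*(⋀T u)) = τ_Ω(μ^*y ∧ ⋀T u) = τ_Ω(⋀T(q^*y ∧ u)) = τ_Ω(q^*y ∧ u)`.
[cite: Beauville2010SL2, §4 (proof of the Theorem)] [cite: Milne1999LefschetzClasses, §5 p. 663 (projection formula)] -/
theorem IsSymplectic.pushforward_map_shear (hω : IsSymplectic ω g) (u : ExteriorAlgebra K (W × W)) :
    hω.pushforward (ExteriorAlgebra.map (LinearMap.inl K W W) ω + ExteriorAlgebra.map (LinearMap.inr K W W) ω) (g + g)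
        (ExteriorAlgebra.map (LinearMap.id.prod LinearMap.id : W →ₗ[K] W × W)).toLinearMap
        (ExteriorAlgebra.map ((LinearMap.fst K W W + LinearMap.snd K W W).prod (LinearMap.snd K W W)) u) =
      gysinSnd ω g u := by
  refine hω.eq_gysinSnd_of_forall_trace_mul_eq hω fun y ↦ ?_
  rw [hω.trace_mul_pushforward (fun j y hy ↦ map_mem_exteriorPower _ hy), AlgHom.toLinearMap_apply, ← map_shear_map_inr, ← map_mul,
    hω.trace_map_shear]

/-- **THE CORRESPONDENCE `δ^*α` ACTS AS THE PONTRYAGIN PRODUCT WITH `α`: `(δ^*α)_* z = z ⋆ α`** (`δ^* = ⋀(inr − inl)`, `δ(a, b) = b − a`;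
Beauville: "`(e^{δ^*θ/a})_* z = q_*σ_*σ^*(e^{δ^*θ/a} · p^*z) = m_*(p^*e^{θ/a} · q^*z) = e^{θ/a} ⋆ z`"): `q_*(p^*z ∧ δ^*α) = μ_*(⋀T(p^*z ∧ δ^*α)) =
μ_*(p^*z ∧ q^*α) = z ⋆ α`. [cite: Beauville2010SL2, §4 (proof of the Theorem)] [cite: Lange2023AbelianVarietiesComplex, §2.5.3 (p0132, the Pontryagin product)] -/
theorem IsSymplectic.corrMap_map_sub_apply (hω : IsSymplectic ω g) (α z : ExteriorAlgebra K W) :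
    corrMap ω g (ExteriorAlgebra.map (LinearMap.inr K W W - LinearMap.inl K W W) α) z = hω.pontryagin z α := by
  rw [corrMap_apply, hω.pontryagin_apply, kunnethEquiv_tmul, ← hω.pushforward_map_shear, map_mul, map_shear_map_inl, map_shear_map_sub]

/-! ## §2 The Poincaré class `℘ = p^*ω + q^*ω − μ^*ω = δ^*ω − p^*ω − q^*ω` and `e^℘ = δ^*e^{ω} · p^*e^{−ω} · q^*e^{−ω}` -/

variable (ω) in
/-- **The class of the Poincaré bundle `℘ = p^*θ + q^*θ − m^*θ ∈ H²(X × X)`** (Beauville's sign convention `φ(a) = 𝒪(Θ_a − Θ)`; the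
principal polarization identifies `X̂` with `X`), on the carrier: `p^*ω + q^*ω − μ^*ω ∈ ⋀²(W ⊕ W)`.
[cite: Beauville2010SL2, §1 (p0002, "the class […] of the Poincaré bundle is p^*θ + q^*θ − m^*θ")] -/
def poincareClass : ExteriorAlgebra K (W × W) :=
  ExteriorAlgebra.map (LinearMap.inl K W W) ω + ExteriorAlgebra.map (LinearMap.inr K W W) ω -
    ExteriorAlgebra.map (LinearMap.id.prod LinearMap.id : W →ₗ[K] W × W) ω

omit [CharZero K] in
/-- `℘ ∈ ⋀²(W ⊕ W)`. [cite: Beauville2010SL2, §1 (p0002)] -/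
theorem poincareClass_mem (hω2 : ω ∈ ⋀[K]^2 W) : poincareClass ω ∈ ⋀[K]^2 (W × W) :=
  Submodule.sub_mem _ (Submodule.add_mem _ (map_mem_exteriorPower _ hω2) (map_mem_exteriorPower _ hω2)) (map_mem_exteriorPower _ hω2)

omit [CharZero K] in
/-- **THE SEESAW IDENTITY `m^*θ + δ^*θ = 2p^*θ + 2q^*θ`** on the carrier: for `ω = Σᵢ eᵢ ∧ fᵢ`, `μ^*(e ∧ f) + δ^*(e ∧ f) =
(e′+e″)(f′+f″) + (e″−e′)(f″−f′) = 2e′f′ + 2e″f″` (the cross terms cancel). [cite: Beauville2010SL2, §3 (proof of the Theorem, "by the seesaw theorem")] -/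
theorem IsSymplectic.map_prod_add_map_sub (hω : IsSymplectic ω g) :
    ExteriorAlgebra.map (LinearMap.id.prod LinearMap.id : W →ₗ[K] W × W) ω + ExteriorAlgebra.map (LinearMap.inr K W W - LinearMap.inl K W W) ω =
      (2 : K) • (ExteriorAlgebra.map (LinearMap.inl K W W) ω + ExteriorAlgebra.map (LinearMap.inr K W W) ω) := by
  obtain ⟨b, rfl⟩ := hω
  simp only [twoVector, map_sum, map_mul, map_apply_ι, Finset.smul_sum, ← Finset.sum_add_distrib]
  refine Finset.sum_congr rfl fun i _ ↦ ?_
  have h1 : ∀ w : W, (LinearMap.id.prod LinearMap.id : W →ₗ[K] W × W) w = LinearMap.inl K W W w + LinearMap.inr K W W w := fun w ↦ by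
    ext <;> simp
  have h2 : ∀ w : W, (LinearMap.inr K W W - LinearMap.inl K W W) w = LinearMap.inr K W W w - LinearMap.inl K W W w := fun w ↦ by
    rw [LinearMap.sub_apply]
  rw [h1, h1, h2, h2, map_add, map_add, map_sub, map_sub, two_smul]
  noncomm_ring

omit [CharZero K] in
/-- **`℘ = δ^*ω − p^*ω − q^*ω`** (`℘ + p^*θ + q^*θ = δ^*θ`, Beauville's `φ(v) = e^{℘ + p^*θ + q^*θ} = e^{δ^*θ}`). [cite: Beauville2010SL2, §3 (proof of the Theorem)] -/
theorem IsSymplectic.poincareClass_eq (hω : IsSymplectic ω g) :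
    poincareClass ω = ExteriorAlgebra.map (LinearMap.inr K W W - LinearMap.inl K W W) ω -
      ExteriorAlgebra.map (LinearMap.inl K W W) ω - ExteriorAlgebra.map (LinearMap.inr K W W) ω := by
  have h := hω.map_prod_add_map_sub
  rw [two_smul] at h
  rw [poincareClass, eq_sub_of_add_eq h]
  abel

/-- The truncated exponential through an algebra map: `exp(F η) = F(Σ_{m<n} η^m/m!)` when `ηⁿ = 0` (Mathlib's `IsNilpotent.exp` for the
`ℚ`-structure through `ℚ → K`, used inside proofs only). [folklore] -/
private theorem exp_map_eq_of_pow_eq_zero {V : Type*} [AddCommGroup V] [Module K V] (F : ExteriorAlgebra K W →ₐ[K] ExteriorAlgebra K V)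
    {η : ExteriorAlgebra K W} {n : ℕ} (hη : η ^ n = 0) :
    letI := Algebra.compHom (ExteriorAlgebra K V) (algebraMap ℚ K)
    IsNilpotent.exp (F η) = F (∑ m ∈ Finset.range n, (m ! : K)⁻¹ • η ^ m) := by
  letI := Algebra.compHom (ExteriorAlgebra K V) (algebraMap ℚ K)
  have hn : F η ^ n = 0 := by rw [← map_pow, hη, map_zero]
  rw [IsNilpotent.exp_eq_sum hn, map_sum]
  refine Finset.sum_congr rfl fun i _ ↦ ?_
  rw [Algebra.compHom_smul_def, map_inv₀, map_natCast, map_smul, map_pow]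

/-- **`e^℘ = δ^*e^{ω} · p^*e^{−ω} · q^*e^{−ω}`** (`℘ = δ^*ω − p^*ω − q^*ω` is a sum of three commuting nilpotent even classes;
`e^{±ω} = Σ_{m≤g} (±ω)^m/m!`, `e^℘ = Σ_{j≤2g} ℘^j/j!` — all exponential series are finite: `ω^{g+1} = 0`, `℘^{2g+1} = 0`).
[cite: Beauville2010SL2, §3 (proof of the Theorem, "φ(v) = Δ_*e^θ ∘ e^℘ ∘ Δ_*e^θ = e^{℘+p^*θ+q^*θ}")] -/
theorem IsSymplectic.sum_inv_factorial_smul_poincareClass_pow (hω : IsSymplectic ω g) :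
    ∑ j ∈ Finset.range (2 * g + 1), (j ! : K)⁻¹ • poincareClass ω ^ j =
      ExteriorAlgebra.map (LinearMap.inr K W W - LinearMap.inl K W W) (∑ m ∈ Finset.range (g + 1), (m ! : K)⁻¹ • ω ^ m) *
        ExteriorAlgebra.map (LinearMap.inl K W W) (∑ m ∈ Finset.range (g + 1), (m ! : K)⁻¹ • (-ω) ^ m) *
          ExteriorAlgebra.map (LinearMap.inr K W W) (∑ m ∈ Finset.range (g + 1), (m ! : K)⁻¹ • (-ω) ^ m) := by
  letI := Algebra.compHom (ExteriorAlgebra K (W × W)) (algebraMap ℚ K)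
  have hΩ := hω.inl_add_inr hω
  have hg1 : ω ^ (g + 1) = 0 := hω.pow_genus_succ_eq_zero
  have hng1 : (-ω) ^ (g + 1) = 0 := by rw [neg_pow, hg1, mul_zero]
  -- `℘^{2g+1} = 0`
  have h℘ : poincareClass ω ^ (2 * g + 1) = 0 := by
    have hm := pow_mem_exteriorPower (poincareClass_mem hω.mem) (2 * g + 1)
    rwa [hΩ.exteriorPower_eq_bot (by omega), Submodule.mem_bot] at hm
  have hexp : ∑ j ∈ Finset.range (2 * g + 1), (j ! : K)⁻¹ • poincareClass ω ^ j = IsNilpotent.exp (poincareClass ω) := by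
    rw [IsNilpotent.exp_eq_sum h℘]
    refine Finset.sum_congr rfl fun i _ ↦ ?_
    rw [Algebra.compHom_smul_def, map_inv₀, map_natCast]
  -- the three summands
  set D := ExteriorAlgebra.map (LinearMap.inr K W W - LinearMap.inl K W W) ω with hD
  set P := ExteriorAlgebra.map (LinearMap.inl K W W) ω with hP
  set Q := ExteriorAlgebra.map (LinearMap.inr K W W) ω with hQ
  have hPn : IsNilpotent (-P) := ⟨g + 1, by rw [hP, ← map_neg, ← map_pow, hng1, map_zero]⟩
  have hQn : IsNilpotent (-Q) := ⟨g + 1, by rw [hQ, ← map_neg, ← map_pow, hng1, map_zero]⟩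
  have hDn : IsNilpotent D := ⟨g + 1, by rw [hD, ← map_pow, hg1, map_zero]⟩
  have hD2 : D ∈ ⋀[K]^2 (W × W) := map_mem_exteriorPower _ hω.mem
  have hP2 : -P ∈ ⋀[K]^2 (W × W) := Submodule.neg_mem _ (map_mem_exteriorPower _ hω.mem)
  have c1 : Commute D (-P + -Q) := mul_comm_of_mem_two hD2 _
  have c2 : Commute (-P) (-Q) := mul_comm_of_mem_two hP2 _
  rw [hexp, hω.poincareClass_eq, ← hD, ← hP, ← hQ, show D - P - Q = D + (-P + -Q) by abel,
    IsNilpotent.exp_add_of_commute c1 hDn (c2.isNilpotent_add hPn hQn), IsNilpotent.exp_add_of_commute c2 hPn hQn, hD, hP, hQ,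
    ← map_neg, ← map_neg, exp_map_eq_of_pow_eq_zero _ hg1, exp_map_eq_of_pow_eq_zero _ hng1, exp_map_eq_of_pow_eq_zero _ hng1, mul_assoc]

omit [CharZero K] in
/-- A finite sum of multiples of powers of a class of degree `2` is central: `(Σ_m c_m η^m) ∧ v = v ∧ (Σ_m c_m η^m)`. [cite: BourbakiAlgebre1a3, Ch. III §7 no. 1] -/
theorem sum_smul_pow_mul_comm {V : Type*} [AddCommGroup V] [Module K V] {η : ExteriorAlgebra K V} (hη : η ∈ ⋀[K]^2 V) (c : ℕ → K) (n : ℕ)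
    (v : ExteriorAlgebra K V) : (∑ m ∈ Finset.range n, c m • η ^ m) * v = v * ∑ m ∈ Finset.range n, c m • η ^ m := by
  rw [Finset.sum_mul, Finset.mul_sum]
  exact Finset.sum_congr rfl fun m _ ↦ by rw [smul_mul_assoc, mul_smul_comm, pow_mul_comm_of_mem_two hη]

/-! ## §3 The Fourier transform `ℱ = (e^℘)_*` and Beauville's theorem `ℱ = w` -/

variable (ω g) in
/-- **The cohomological Fourier (–Mukai) transform `ℱ = (e^℘)_* : H•(X) → H•(X)`, `ℱ(x) = q_*(p^*x ∪ e^℘)`**, of a principally polarized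
abelian variety (Beauville's "`ℱ` the `ℚ`-linear automorphism `d⁻¹(e^℘)_*`", `d = 1`), on the carrier: Milne's dictionary `corrMap ω g`
(`u ↦ (x ↦ q_*(p^*x ∧ u))`) at the finite exponential `e^℘ = Σ_{j≤2g} ℘^j/j!` of the Poincaré class.
[cite: Beauville2010SL2, §4 (p0005, "the Fourier transform for Chow groups") and §1 (α_* z = q_*(α · p^*z))] [cite: Lange2023AbelianVarietiesComplex, §6.2.4 (6.11)] -/
def fourierTransform : ExteriorAlgebra K W →ₗ[K] ExteriorAlgebra K W :=
  corrMap ω g (∑ j ∈ Finset.range (2 * g + 1), (j ! : K)⁻¹ • poincareClass ω ^ j)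

/-- `ℱ x = q_*(p^*x ∧ e^℘)` (definitional). [cite: Beauville2010SL2, §4 (p0005)] -/
theorem fourierTransform_apply (x : ExteriorAlgebra K W) :
    fourierTransform ω g x = gysinSnd ω g (ExteriorAlgebra.map (LinearMap.inl K W W) x * ∑ j ∈ Finset.range (2 * g + 1), (j ! : K)⁻¹ • poincareClass ω ^ j) :=
  rfl

/-- **`ℱ x = e^{−ω} ∧ ((e^{−ω} ∧ x) ⋆ e^{ω})`** — Beauville's `w = u⁻¹ v u⁻¹` read on `H•`: `(e^℘)_* = (δ^*e^θ · p^*e^{−θ} · q^*e^{−θ})_* =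
e^{−θ} ∧ (δ^*e^{θ})_*(e^{−θ} ∧ ·)` by (a), and `(δ^*e^{θ})_* y = y ⋆ e^{θ}` (§1). [cite: Beauville2010SL2, §3 (proof of the Theorem) and §4 (Theorem, proof)] -/
theorem IsSymplectic.fourierTransform_apply_eq (hω : IsSymplectic ω g) (x : ExteriorAlgebra K W) :
    fourierTransform ω g x = (∑ m ∈ Finset.range (g + 1), (m ! : K)⁻¹ • (-ω) ^ m) *
      hω.pontryagin ((∑ m ∈ Finset.range (g + 1), (m ! : K)⁻¹ • (-ω) ^ m) * x) (∑ m ∈ Finset.range (g + 1), (m ! : K)⁻¹ • ω ^ m) := by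
  have hneg2 : -ω ∈ ⋀[K]^2 W := Submodule.neg_mem _ hω.mem
  have hcW : ∀ v : ExteriorAlgebra K W, (∑ m ∈ Finset.range (g + 1), (m ! : K)⁻¹ • (-ω) ^ m) * v =
      v * ∑ m ∈ Finset.range (g + 1), (m ! : K)⁻¹ • (-ω) ^ m := sum_smul_pow_mul_comm hneg2 _ _
  have hcP : ∀ v : ExteriorAlgebra K (W × W),
      ExteriorAlgebra.map (LinearMap.inl K W W) (∑ m ∈ Finset.range (g + 1), (m ! : K)⁻¹ • (-ω) ^ m) * v =
        v * ExteriorAlgebra.map (LinearMap.inl K W W) (∑ m ∈ Finset.range (g + 1), (m ! : K)⁻¹ • (-ω) ^ m) := fun v ↦ by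
    simp only [map_sum, map_smul, map_pow]
    exact sum_smul_pow_mul_comm (map_mem_exteriorPower _ hneg2) _ _ v
  rw [fourierTransform, hω.sum_inv_factorial_smul_poincareClass_pow, corrMap_mul_map_inr_apply, ← hcP, corrMap_map_inl_mul_apply,
    hω.corrMap_map_sub_apply, ← hcW x]
  exact (hcW _).symm

/-- **BEAUVILLE'S THEOREM ON `H•(X) = ⋀W`: THE FOURIER TRANSFORM IS THE WEYL ELEMENT, `ℱ = w`** ("`(0 −1 ; 1 0)·z = ℱ(z)`" for the
`SL₂`-action with `u ↦ e^{θ}·`, `v ↦ e^{θ} ⋆ ·`; here `w = weylStar ω g = exp(Λ) exp(−L) exp(Λ) = exp(−L) exp(Λ) exp(−L)`, `g ≥ 1`).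
[cite: Beauville2010SL2, §4 Theorem ("(0 −1 ; 1 0)·z = ℱ(z)")] [cite: Andre1996Motifs, §1.2 (p. 11)] -/
theorem IsSymplectic.fourierTransform_eq_weylStar (hω : IsSymplectic ω g) (hg : 0 < g) : fourierTransform ω g = weylStar ω g :=
  LinearMap.ext fun x ↦ by rw [hω.fourierTransform_apply_eq, hω.weylStar_apply_eq_pontryagin hg]

/-! ## §4 Consequences: `ℱ² = (−1)^{g+k}`, `ℱ⁴ = 1`, `ℱ L = −Λ ℱ`, `ℱ = ±*_H`, `ℱ ∈ K[L, Λ]`, Beauville's Corollary and formula -/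

/-- `ℱ(Hᵏ) ⊆ H^{2g−k}`. [cite: Beauville2010SL2, §4 Theorem] [cite: Lange2023AbelianVarietiesComplex, §6.2.4 (6.11)] -/
theorem IsSymplectic.fourierTransform_apply_mem (hω : IsSymplectic ω g) (hg : 0 < g) {k l : ℕ} (hkl : k + l = 2 * g)
    {x : ExteriorAlgebra K W} (hx : x ∈ ⋀[K]^k W) : fourierTransform ω g x ∈ ⋀[K]^l W := by
  rw [hω.fourierTransform_eq_weylStar hg]
  exact hω.weylStar_apply_mem hkl hx

/-- **`ℱ(ℱ x) = (−1)^{g+k} x` on `Hᵏ`** (Beauville: `w² = (−1 0 ; 0 −1)` acts as `(−1)^{−g}(−1)^*`, and `(−1)^* = (−1)^k` on `Hᵏ`; Mukai's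
inversion `ℱ ∘ ℱ = (−1)^g (−1)^*`). [cite: Beauville2010SL2, §4 Theorem ("(n 0 ; 0 n⁻¹)·z = n^{−g} n^*z")] [cite: Lange2023AbelianVarietiesComplex, §6.2.3 Cor. 6.2.16] -/
theorem IsSymplectic.fourierTransform_fourierTransform_apply (hω : IsSymplectic ω g) (hg : 0 < g) {k : ℕ} {x : ExteriorAlgebra K W}
    (hx : x ∈ ⋀[K]^k W) : fourierTransform ω g (fourierTransform ω g x) = ((-1 : K) ^ (k + g)) • x := by
  rw [hω.fourierTransform_eq_weylStar hg]
  exact hω.weylStar_weylStar_apply_of_mem hx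

/-- **`ℱ⁴ = 1`** (`w⁴ = 1` in `SL₂(ℤ)`). [cite: Beauville2010SL2, §2 ("w⁴ = 1") and §4 Theorem] -/
theorem IsSymplectic.fourierTransform_pow_four (hω : IsSymplectic ω g) (hg : 0 < g) : fourierTransform ω g ^ 4 = 1 := by
  rw [hω.fourierTransform_eq_weylStar hg]
  exact hω.weylStar_pow_four

/-- **`ℱ ∘ L = −Λ ∘ ℱ`** (`w X w⁻¹ = −Y`: the Fourier transform exchanges the Lefschetz operator `θ ∧ ·` and `· ⋆ θ^{[g−1]} = Λ` up to sign).
[cite: Beauville2010SL2, §4 Theorem (X = θ·, Y = θ^{g−1}/(g−1)! ⋆)] [cite: Andre1996Motifs, §1.2 (p. 11)] -/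
theorem IsSymplectic.fourierTransform_mul_mul (hω : IsSymplectic ω g) (hg : 0 < g) :
    fourierTransform ω g * LinearMap.mul K (ExteriorAlgebra K W) ω = -(lefschetzDual ω g * fourierTransform ω g) := by
  rw [hω.fourierTransform_eq_weylStar hg]
  exact hω.weylStar_mul_mul hg

/-- **`ℱ ∘ Λ = −L ∘ ℱ`** (`w Y w⁻¹ = −X`). [cite: Beauville2010SL2, §4 Theorem] [cite: Andre1996Motifs, §1.2 (p. 11)] -/
theorem IsSymplectic.fourierTransform_mul_lefschetzDual (hω : IsSymplectic ω g) (hg : 0 < g) :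
    fourierTransform ω g * lefschetzDual ω g = -(LinearMap.mul K (ExteriorAlgebra K W) ω * fourierTransform ω g) := by
  rw [hω.fourierTransform_eq_weylStar hg]
  exact hω.weylStar_mul_lefschetzDual hg

/-- **`ℱ = (−1)^{g + k(k−1)/2} · *_H` on `Hᵏ`**: the Fourier transform is André's Hodge involution up to the sign ("l'élément `(0 1 ; −1 0)` de
`SL₂` s'envoie sur `± *_H`"). [cite: Andre1996Motifs, §1.2 (p. 11)] [cite: Beauville2010SL2, §4 Theorem] -/
theorem IsSymplectic.fourierTransform_apply_eq_smul_andreStar (hω : IsSymplectic ω g) (hg : 0 < g) {k : ℕ} {x : ExteriorAlgebra K W}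
    (hx : x ∈ ⋀[K]^k W) : fourierTransform ω g x = ((-1 : K) ^ (g + k.choose 2)) • andreStar ω g x := by
  rw [hω.fourierTransform_eq_weylStar hg]
  exact hω.weylStar_apply_of_mem hx

/-- **`ℱ` is `Sp(ω)`-equivariant** (`⋀f ∘ ℱ = ℱ ∘ ⋀f` whenever `⋀f ω = ω`): the Fourier transform is a Lefschetz operator.
[cite: Milne1999LefschetzClasses, §5 Thm. 5.9 (proof)] [cite: Beauville2010SL2, §4 Theorem] -/
theorem IsSymplectic.map_fourierTransform (hω : IsSymplectic ω g) (hg : 0 < g) (f : W →ₗ[K] W) (hf : ExteriorAlgebra.map f ω = ω)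
    (x : ExteriorAlgebra K W) : ExteriorAlgebra.map f (fourierTransform ω g x) = fourierTransform ω g (ExteriorAlgebra.map f x) := by
  rw [hω.fourierTransform_eq_weylStar hg]
  exact hω.map_weylStar f hf x

/-- **`ℱ ∈ K[L, Λ]`**: the Fourier transform lies in the algebra generated by the Lefschetz operators (Milne's `ℚ[L, Λ]`, hence is algebraic
and Lefschetz). [cite: Milne1999LefschetzClasses, §5 Thm. 5.9 (proof, "all elements of the ℚ-algebra ℚ[L, Λ] are Lefschetz")] [cite: Beauville2010SL2, §4 Theorem] -/
theorem IsSymplectic.fourierTransform_mem_adjoin (hω : IsSymplectic ω g) (hg : 0 < g) :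
    fourierTransform ω g ∈ Algebra.adjoin K ({LinearMap.mul K (ExteriorAlgebra K W) ω, lefschetzDual ω g} : Set (Module.End K (ExteriorAlgebra K W))) := by
  rw [hω.fourierTransform_eq_weylStar hg]
  exact hω.weylStar_mem_adjoin_lefschetzDual hg

/-- **BEAUVILLE'S COROLLARY `ℱ(ω^q/q! ∧ p) = (−ω)^r/r! ∧ p`** for a primitive `p ∈ Pᵏ` (`Λp = 0`, i.e. "`θ^{g−1} ⋆ z = 0`") and `q + r = g − k`
("`ℱ(θ^q/q! z) = (−θ)^r/r! z` with `r = g + s − 2p − q`", `s = 0`, `2p = k`). [cite: Beauville2010SL2, §5 Corollary] -/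
theorem IsSymplectic.fourierTransform_apply_inv_factorial_smul_pow_mul_of_mem_primitive (hω : IsSymplectic ω g) (hg : 0 < g) {k : ℕ}
    (hk : k ≤ g) {p : ExteriorAlgebra K W} (hp : p ∈ primitive ω g k) {q r : ℕ} (hqr : q + r = g - k) :
    fourierTransform ω g ((q ! : K)⁻¹ • (ω ^ q * p)) = (r ! : K)⁻¹ • ((-ω) ^ r * p) := by
  rw [hω.fourierTransform_eq_weylStar hg]
  exact hω.weylStar_apply_inv_factorial_smul_pow_mul_of_mem_primitive hk hp hqr

/-- **`ℱ(ω^q/q!) = (−ω)^r/r!` for `q + r = g`** — Beauville's formula / Lange's Thm. 6.3.5 "`F(L^{·p}/p!) = ((−1)^{g−p}/d) φ_{L*}(L^{·(g−p)}/(g−p)!)`"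
for a principal polarization (`d = 1`, `X̂ = X`), in cohomology: the constants `1 ∈ P⁰` are primitive. [cite: Lange2023AbelianVarietiesComplex, §6.3.2 Thm. 6.3.5 (p0315)]
[cite: Beauville2010SL2, §5 Corollary] -/
theorem IsSymplectic.fourierTransform_inv_factorial_smul_pow (hω : IsSymplectic ω g) (hg : 0 < g) {q r : ℕ} (hqr : q + r = g) :
    fourierTransform ω g ((q ! : K)⁻¹ • ω ^ q) = (r ! : K)⁻¹ • (-ω) ^ r := by
  have h1 : (1 : ExteriorAlgebra K W) ∈ primitive ω g 0 :=
    hω.le_primitive_of_le_one (by omega) (by rw [exteriorPower, pow_zero]; exact Submodule.one_le.mp le_rfl)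
  have := hω.fourierTransform_apply_inv_factorial_smul_pow_mul_of_mem_primitive hg (Nat.zero_le g) h1 (q := q) (r := r) (by omega)
  rwa [mul_one, mul_one] at this

/-- **`ℱ(1) = (−ω)^g/g! = (−1)^g [pt]`**: the Fourier transform of the fundamental class is `(−1)^g` times the point class `ω^g/g!`
(Lange Cor. 6.2.16 "`F(1) = (−1)^g [pt]`"). [cite: Lange2023AbelianVarietiesComplex, §6.2.3 Cor. 6.2.16] [cite: Beauville2010SL2, §5 Corollary] -/
theorem IsSymplectic.fourierTransform_one (hω : IsSymplectic ω g) (hg : 0 < g) :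
    fourierTransform ω g 1 = ((-1 : K) ^ g * (g ! : K)⁻¹) • ω ^ g := by
  have := hω.fourierTransform_inv_factorial_smul_pow hg (q := 0) (r := g) (zero_add g)
  rw [Nat.factorial_zero, Nat.cast_one, inv_one, pow_zero, one_smul] at this
  have hneg : (-ω) ^ g = ((-1 : K) ^ g) • ω ^ g := by rw [← smul_pow, neg_one_smul]
  rw [this, hneg, smul_smul, mul_comm]

/-- **`ℱ[pt] = 1`**: the Fourier transform of the point class `[pt] = ω^g/g!` is the fundamental class. [cite: Lange2023AbelianVarietiesComplex, §6.2.3 Cor. 6.2.16]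
[cite: Beauville2010SL2, §5 Corollary] -/
theorem IsSymplectic.fourierTransform_point (hω : IsSymplectic ω g) (hg : 0 < g) :
    fourierTransform ω g ((g ! : K)⁻¹ • ω ^ g) = 1 := by
  have := hω.fourierTransform_inv_factorial_smul_pow hg (q := g) (r := 0) (add_zero g)
  rwa [Nat.factorial_zero, Nat.cast_one, inv_one, pow_zero, one_smul] at this

/-- **MUKAI'S INVERSION FORMULA `ℱ ∘ ℱ = (−1)^g (−1)^*`** as an identity of operators on `H•(X) = ⋀W` (`(−1)^* = ⋀(−1)` acts by `(−1)^k` on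
`Hᵏ`; Beauville: `w² = (−1 0 ; 0 −1) ↦ (−1)^{−g}(−1)^*`). [cite: Beauville2010SL2, §2 ("(Φ_P)² = (−1_A)^*[−g]") and §4 Theorem] [cite: Lange2023AbelianVarietiesComplex, §6.2.3 Cor. 6.2.16] -/
theorem IsSymplectic.fourierTransform_mul_fourierTransform (hω : IsSymplectic ω g) (hg : 0 < g) :
    fourierTransform ω g * fourierTransform ω g =
      ((-1 : K) ^ g) • (ExteriorAlgebra.map ((-1 : K) • (LinearMap.id : W →ₗ[K] W))).toLinearMap := by
  refine LinearMap.ext fun x ↦ ?_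
  rw [Module.End.mul_apply, LinearMap.smul_apply, AlgHom.toLinearMap_apply]
  induction x using DirectSum.Decomposition.inductionOn (fun i : ℕ ↦ ⋀[K]^i W) with
  | zero => rw [map_zero, map_zero, map_zero, smul_zero]
  | add x y hx hy => rw [map_add, map_add, hx, hy, map_add, smul_add]
  | @homogeneous k x =>
    rw [hω.fourierTransform_fourierTransform_apply hg x.2, map_smul_id_apply_of_mem _ x.2, smul_smul, ← pow_add, add_comm]

/-- **`ℱ` is bijective** (`ℱ⁴ = 1`). [cite: Beauville2010SL2, §4 ("the ℚ-linear automorphism d⁻¹(e^℘)_*")] -/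
theorem IsSymplectic.fourierTransform_bijective (hω : IsSymplectic ω g) (hg : 0 < g) : Function.Bijective (fourierTransform ω g) := by
  have h4 := hω.fourierTransform_pow_four hg
  have h3 : fourierTransform ω g * fourierTransform ω g ^ 3 = 1 := by rw [← pow_succ', h4]
  have h3' : fourierTransform ω g ^ 3 * fourierTransform ω g = 1 := by rw [← pow_succ, h4]
  refine ⟨fun x y hxy ↦ ?_, fun y ↦ ⟨(fourierTransform ω g ^ 3) y, ?_⟩⟩
  · have := congrArg (fun z ↦ (fourierTransform ω g ^ 3) z) hxy
    rwa [← Module.End.mul_apply, ← Module.End.mul_apply, h3', Module.End.one_apply, Module.End.one_apply] at this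
  · rw [← Module.End.mul_apply, h3, Module.End.one_apply]

/-- **PARSEVAL / SELF-ADJOINTNESS: `τ(ℱx ∧ y) = τ(x ∧ ℱy)`** — `ℱ = exp(−L) exp(Λ) exp(−L)` is a palindrome in the `τ`-self-adjoint
operators `L` and `Λ` (`τ(Λz ∧ y) = τ(z ∧ Λy)`, row g30), hence `τ`-self-adjoint (the printed sources do not spell this out for `ℱ` on one
variety; it is the shadow of Parseval/Plancherel for `X × X̂`, Lange §6.2.4). [cite: Beauville2010SL2, §4 Theorem] [cite: Voisin2002, §6.2.1 Lemma 6.19]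
[cite: Lange2023AbelianVarietiesComplex, §6.2.4 Prop. 6.2.20 (pp. 310–311)] -/
theorem IsSymplectic.trace_fourierTransform_mul (hω : IsSymplectic ω g) (hg : 0 < g) (x y : ExteriorAlgebra K W) :
    trace ω g (fourierTransform ω g x * y) = trace ω g (x * fourierTransform ω g y) := by
  have hneg2 : -ω ∈ ⋀[K]^2 W := Submodule.neg_mem _ hω.mem
  set em := ∑ m ∈ Finset.range (g + 1), (m ! : K)⁻¹ • (-ω) ^ m with he
  set E : Module.End K (ExteriorAlgebra K W) := ∑ k ∈ Finset.range (g + 1), (k ! : K)⁻¹ • lefschetzDual ω g ^ k with hE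
  have hcW : ∀ v : ExteriorAlgebra K W, em * v = v * em := sum_smul_pow_mul_comm hneg2 _ _
  have hM : ∀ a b : ExteriorAlgebra K W, trace ω g (em * a * b) = trace ω g (a * (em * b)) := fun a b ↦ by
    rw [hcW a, mul_assoc]
  have hEadj : ∀ a b : ExteriorAlgebra K W, trace ω g (E a * b) = trace ω g (a * E b) := fun a b ↦ by
    simp only [hE, LinearMap.sum_apply, LinearMap.smul_apply, Finset.sum_mul, Finset.mul_sum, map_sum, smul_mul_assoc, mul_smul_comm,
      map_smul]
    refine Finset.sum_congr rfl fun k _ ↦ ?_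
    have := LinearMap.congr_fun (hω.trace_comp_mulRight_lefschetzDual_pow_apply hg k b) a
    simp only [LinearMap.comp_apply, LinearMap.mulRight_apply] at this
    rw [this]
  rw [hω.fourierTransform_eq_weylStar hg, hω.weylStar_eq_mul_exp hg, ← he, ← hE]
  simp only [Module.End.mul_apply, LinearMap.mul_apply']
  rw [hM, hEadj, ← hM]

end ExteriorLefschetz

end Literature.AlgebraicGeometry.Motives
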